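import Summits.QuantumAdvantage.QuantumAdvantage.Theorems.LocusDialAffinePointerC

/-!
# LocusDialAffinePointerD — ADAPTIVE linear queries: `𝔽₃`-parity decision trees (part D; the rung `AdaptiveAffinePointerLoss3` PROVED)

Cell decomp-qadv, seat lens-2, generation 17 — fourth tree part of «AffinePointer» (supports item stmt-QuantumAdvantage-27137
`Theses.StabilizerDial.FewLocusLoss3`).  Parts A–C prove `AffinePointerLoss3` (non-adaptive hash).  THIS PART upgrades the pointer
class to ADAPTIVE linear queries — an `𝔽₃`-PARITY DECISION TREE of depth `t` (`Adaptive M`: the `j`-th queried form depends only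
on the earlier answers; ordinary bit-reading decision trees are the coordinate-form case, a non-adaptive hash is a constant
scheme) — and to EVERY depth `t` with `16t + 42 ≤ n` (linear depth, not just polylog):
* `leafOf` (the answer string of an input), `linHash_leafOf` / `eq_leafOf_of_consistent` / `leafOf_eq_iff` (the leaves are
  exactly the affine fibres `{L^v(x) = v}` of the leaf's OWN query matrix, so they partition the cube);
* `adaptivePointer_loss`: for all `n, t` with `16t + 42 ≤ n`, every adaptive scheme `M` and every lookup `π`, the pointer
  `π(leafOf M x)` hits the kernel on at most `(3/4)·2^{n-1}` odd inputs (the per-fibre transfer-operator bound of part C is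
  uniform in the matrix, so it applies leaf by leaf);
* the rung `AdaptiveAffinePointerLoss3` in the format of `AffinePointerLoss3` and its proof `adaptiveAffinePointerLoss3` (`C = 1`);
* its PLACE in the chain: `adaptiveAffinePointerLoss3_of_freePointerLoss3` (NECESSITY — the leaf lookup is a free pointer of
  degree `2t` declaring exactly one position: `adAnchor`, `adAnchor_apply`, `adAnchor_mem`, `adAnchor_filter`) and
  `affinePointerLoss3_of_adaptive` (the constant scheme), i.e. `FreePointerLoss3 → AdaptiveAffinePointerLoss3 → AffinePointerLoss3`.
WHAT THIS IS NOT: not `FreePointerLoss3` — a general degree-`(log n)^c` anchor family has level sets that are not affine fibres; the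
character expansion of such a fibre carries degree-`(log n)^c` phases, outside the two-state transfer operator (and inside the
Razborov–Smolensky / nonclassical-degree regime).  No `sorry`; standard axioms; no instances, no notation.
-/

set_option linter.dupNamespace false

noncomputable section

open scoped Classical

namespace Summit.QuantumAdvantage.QuantumAdvantage.Theorems.LocusDial

open Finset
open Literature.Computability.QuantumComplexity Literature.Computability.QuantumComplexity.RingHLF
open Summit.QuantumAdvantage.AdviceFreeQNC0
open Summit.QuantumAdvantage.QuantumAdvantage.Theorems.HolonomyDial (gCond)

/-! ## §E  ADAPTIVE linear queries: `𝔽₃`-parity decision trees of depth `t` (every `t` with `16t + 42 ≤ n`) -/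

section Adaptive

open Literature.Computability.MetaComplexity Literature.Computability.MetaComplexity.Smolensky

variable {N t : ℕ}

/-- an ADAPTIVE linear query scheme (`𝔽₃`-parity decision tree of depth `t`): on answer string `v` the `j`-th queried
linear form `M v j` depends only on the earlier answers `v i`, `i < j`.  A non-adaptive hash is a constant scheme. -/
def Adaptive (M : (Fin t → ZMod 3) → Fin t → Fin N → ZMod 3) : Prop :=
  ∀ v w : Fin t → ZMod 3, ∀ j : Fin t, (∀ i : Fin t, i.val < j.val → v i = w i) → M v j = M w j

/-- the partial answer string after `j` queries (entries `≥ j` are `0`). -/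
def leafAux (M : (Fin t → ZMod 3) → Fin t → Fin N → ZMod 3) (x : Fin N → Bool) : ℕ → (Fin t → ZMod 3)
  | 0 => fun _ => 0
  | j + 1 => fun i => if i.val = j then linHash (M (leafAux M x j)) x i else leafAux M x j i

/-- the LEAF of input `x`: its full answer string in the query tree. -/
def leafOf (M : (Fin t → ZMod 3) → Fin t → Fin N → ZMod 3) (x : Fin N → Bool) : Fin t → ZMod 3 := leafAux M x t

/-- LocusDialAffinePointerD helper `leafAux_succ_apply` (decomp-qadv land package; see the module docstring). -/
theorem leafAux_succ_apply (M : (Fin t → ZMod 3) → Fin t → Fin N → ZMod 3) (x : Fin N → Bool) (j : ℕ) (i : Fin t) :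
    leafAux M x (j + 1) i = if i.val = j then linHash (M (leafAux M x j)) x i else leafAux M x j i := rfl

/-- LocusDialAffinePointerD helper `leafAux_stable` (decomp-qadv land package; see the module docstring). -/
theorem leafAux_stable (M : (Fin t → ZMod 3) → Fin t → Fin N → ZMod 3) (x : Fin N → Bool) (i : Fin t) :
    ∀ j : ℕ, i.val < j → leafAux M x j i = leafAux M x (i.val + 1) i := by
  intro j hj
  induction j with
  | zero => omega
  | succ j ih =>
    by_cases h : i.val = j
    · subst h; rfl
    · rw [leafAux_succ_apply, if_neg h, ih (by omega)]

/-- LocusDialAffinePointerD helper `leafOf_apply` (decomp-qadv land package; see the module docstring). -/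
theorem leafOf_apply (M : (Fin t → ZMod 3) → Fin t → Fin N → ZMod 3) (x : Fin N → Bool) (i : Fin t) :
    leafOf M x i = linHash (M (leafAux M x i.val)) x i := by
  unfold leafOf
  rw [leafAux_stable M x i t i.isLt, leafAux_succ_apply, if_pos rfl]

/-- LocusDialAffinePointerD helper `leafAux_eq_leafOf` (decomp-qadv land package; see the module docstring). -/
theorem leafAux_eq_leafOf (M : (Fin t → ZMod 3) → Fin t → Fin N → ZMod 3) (x : Fin N → Bool) (j : ℕ) (i : Fin t)
    (hi : i.val < j) : leafAux M x j i = leafOf M x i := by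
  unfold leafOf
  rw [leafAux_stable M x i j hi, leafAux_stable M x i t i.isLt]

/-- the leaf answers its own queries: `L^{leaf(x)}(x) = leaf(x)`. -/
theorem linHash_leafOf {M : (Fin t → ZMod 3) → Fin t → Fin N → ZMod 3} (hM : Adaptive M) (x : Fin N → Bool) :
    linHash (M (leafOf M x)) x = leafOf M x := by
  funext i
  rw [leafOf_apply M x i]
  unfold linHash
  rw [hM (leafOf M x) (leafAux M x i.val) i (fun l hl => (leafAux_eq_leafOf M x i.val l hl).symm)]

/-- uniqueness: an answer string consistent with its own queries IS the leaf. -/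
theorem eq_leafOf_of_consistent {M : (Fin t → ZMod 3) → Fin t → Fin N → ZMod 3} (hM : Adaptive M)
    (x : Fin N → Bool) (w : Fin t → ZMod 3) (hw : linHash (M w) x = w) : w = leafOf M x := by
  have key : ∀ m : ℕ, ∀ i : Fin t, i.val < m → w i = leafOf M x i := by
    intro m
    induction m with
    | zero => intro i hi; omega
    | succ m ih =>
      intro i hi
      by_cases him : i.val < m
      · exact ih i him
      · have hagree : ∀ l : Fin t, l.val < i.val → w l = leafOf M x l := fun l hl => ih l (by omega)
        rw [leafOf_apply M x i, ← congrFun hw i]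
        unfold linHash
        rw [hM w (leafAux M x i.val) i (fun l hl => by rw [hagree l hl, leafAux_eq_leafOf M x i.val l hl])]
  funext i
  exact key t i i.isLt

/-- the fibres of the leaf map are the affine fibres of the leaf's own query matrix. -/
theorem leafOf_eq_iff {M : (Fin t → ZMod 3) → Fin t → Fin N → ZMod 3} (hM : Adaptive M) (x : Fin N → Bool)
    (v : Fin t → ZMod 3) : leafOf M x = v ↔ linHash (M v) x = v :=
  ⟨fun h => by rw [← h]; exact linHash_leafOf hM x, fun h => (eq_leafOf_of_consistent hM x v h).symm⟩

/-- a constant (non-adaptive) scheme is adaptive, and its leaf is the hash. -/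
theorem adaptive_const (M₀ : Fin t → Fin N → ZMod 3) : Adaptive (fun _ : Fin t → ZMod 3 => M₀) :=
  fun _ _ _ _ => rfl

/-- LocusDialAffinePointerD helper `leafOf_const` (decomp-qadv land package; see the module docstring). -/
theorem leafOf_const (M₀ : Fin t → Fin N → ZMod 3) (x : Fin N → Bool) :
    leafOf (fun _ : Fin t → ZMod 3 => M₀) x = linHash M₀ x :=
  (leafOf_eq_iff (adaptive_const M₀) x (linHash M₀ x)).2 rfl

/-- **ADAPTIVE POINTER LOSS** (all `n`, `t` with `16t + 42 ≤ n`): a pointer that is ANY lookup of the leaf of ANY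
`𝔽₃`-parity decision tree of depth `t` hits the kernel on at most `3/4` of `2^{n-1}`. -/
theorem adaptivePointer_loss (n t : ℕ) (htN : 16 * t + 42 ≤ n) (M : (Fin t → ZMod 3) → Fin t → Fin n → ZMod 3)
    (hM : Adaptive M) (π : (Fin t → ZMod 3) → Fin n) :
    ((univ.filter fun x : Fin n → Bool => OddZeros x ∧ gCond x (π (leafOf M x)).val).card : ℝ) ≤
      3 / 4 * (2 : ℝ) ^ (n - 1) := by
  -- the sets
  set Odd := (univ : Finset (Fin n → Bool)).filter (fun x => OddZeros x) with hOdd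
  set G : (Fin n → Bool) → Prop := fun x => gCond x (π (leafOf M x)).val with hG
  set L := Odd.filter (fun x => kph x (π (leafOf M x)).val = 2) with hL
  have hW : (univ.filter fun x : Fin n → Bool => OddZeros x ∧ gCond x (π (leafOf M x)).val) = Odd.filter G := by
    rw [hOdd, filter_filter]
  have hLG : L = Odd.filter (fun x => ¬ G x) := by
    rw [hL]
    apply filter_congr
    intro x _
    rw [hG]
    simp only [gCond_iff_kph, not_not]
  have hWL : (Odd.filter G).card + L.card = Odd.card := by
    rw [hLG]
    exact card_filter_add_card_filter_not _
  have hOdd_le : Odd.card ≤ 2 ^ (n - 1) := HolonomyDial.card_odd_le (by omega)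
  -- fibres = affine fibres of the leaf's own matrix
  have hfibv : ∀ v : Fin t → ZMod 3, Odd.filter (fun x => leafOf M x = v) = fib (M v) v := by
    intro v
    unfold fib
    exact filter_congr (fun x _ => leafOf_eq_iff hM x v)
  have hOdd_fib : Odd.card = ∑ v : Fin t → ZMod 3, (fib (M v) v).card := by
    rw [card_eq_sum_card_fiberwise (f := fun x => leafOf M x) (t := (univ : Finset (Fin t → ZMod 3)))
      (fun x _ => mem_univ _)]
    exact sum_congr rfl (fun v _ => by rw [← hfibv v])
  have hL_fib : L.card = ∑ v : Fin t → ZMod 3, ((fib (M v) v).filter (fun x => kph x (π v).val = 2)).card := by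
    rw [card_eq_sum_card_fiberwise (f := fun x => leafOf M x) (t := (univ : Finset (Fin t → ZMod 3)))
      (fun x _ => mem_univ _)]
    apply sum_congr rfl
    intro v _
    congr 1
    ext x
    rw [hL, hOdd]
    unfold fib
    simp only [mem_filter, mem_univ, true_and]
    constructor
    · rintro ⟨⟨ho, hk⟩, hv⟩
      have hv' : linHash (M v) x = v := (leafOf_eq_iff hM x v).1 hv
      exact ⟨⟨ho, hv'⟩, by rw [← hv]; exact hk⟩
    · rintro ⟨⟨ho, hv'⟩, hk⟩
      have hv : leafOf M x = v := (leafOf_eq_iff hM x v).2 hv'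
      exact ⟨⟨ho, by rw [hv]; exact hk⟩, hv⟩
  have hfib : ∀ v : Fin t → ZMod 3, ((fib (M v) v).card : ℝ) ≤
      3 * ((fib (M v) v).filter (fun x => kph x (π v).val = 2)).card + 2 ^ n / (8 * 3 ^ t) := by
    intro v
    have h0 := fibre_count_le (M v) v (π v).val
    have h1 := fibSum_bound (M v) v (show (1 : ZMod 3) ≠ 0 by decide) (π v).val htN
    have h2 := fibSum_bound (M v) v (show (2 : ZMod 3) ≠ 0 by decide) (π v).val htN
    have hb1 : ‖fibSum (M v) v 1 (π v).val‖ ≤ 2 ^ n / (16 * 3 ^ t) := by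
      rw [le_div_iff₀ (by positivity)]; linarith
    have hb2 : ‖fibSum (M v) v 2 (π v).val‖ ≤ 2 ^ n / (16 * 3 ^ t) := by
      rw [le_div_iff₀ (by positivity)]; linarith
    have e : (2 : ℝ) ^ n / (16 * 3 ^ t) + 2 ^ n / (16 * 3 ^ t) = 2 ^ n / (8 * 3 ^ t) := by
      field_simp; ring
    linarith
  have hmain : (Odd.card : ℝ) ≤ 3 * L.card + 2 ^ n / 8 := by
    rw [hOdd_fib, hL_fib]
    push_cast
    have hs := sum_le_sum (fun v (_ : v ∈ (univ : Finset (Fin t → ZMod 3))) => hfib v)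
    rw [sum_add_distrib, sum_const, card_univ, Fintype.card_fun, ZMod.card, Fintype.card_fin, nsmul_eq_mul,
      ← mul_sum] at hs
    push_cast at hs
    have e : (3 : ℝ) ^ t * (2 ^ n / (8 * 3 ^ t)) = 2 ^ n / 8 := by
      field_simp
    linarith
  -- the count
  rw [hW]
  have hWr : ((Odd.filter G).card : ℝ) = Odd.card - L.card := by
    have := congrArg (fun m : ℕ => (m : ℝ)) hWL
    push_cast at this
    linarith
  have hOl : (Odd.card : ℝ) ≤ 2 ^ (n - 1) := by exact_mod_cast hOdd_le
  have hpow : (2 : ℝ) ^ n = 2 * 2 ^ (n - 1) := by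
    rw [← pow_succ']; congr 1; omega
  rw [hWr]
  linarith

/-- **`AdaptiveAffinePointerLoss3`** — the polylog-depth rung in the format of `AffinePointerLoss3`: no pointer that is a
lookup of the leaf of an `𝔽₃`-parity decision tree of depth `t ≤ (log₂ n)^c` hits the kernel on all but a polynomial
fraction of the odd class.  Sits between `FreePointerLoss3` and `AffinePointerLoss3`
(`adaptiveAffinePointerLoss3_of_freePointerLoss3`, `affinePointerLoss3_of_adaptive`).  PROVED below. -/
def AdaptiveAffinePointerLoss3 : Prop :=
  ∃ C : ℕ, ∀ c : ℕ, ∃ n₀ : ℕ, ∀ n ≥ n₀, ∀ t : ℕ, t ≤ (Nat.log 2 n) ^ c →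
    ∀ M : (Fin t → ZMod 3) → Fin t → Fin n → ZMod 3, Adaptive M → ∀ π : (Fin t → ZMod 3) → Fin n,
      ((univ.filter fun x : Fin n → Bool => OddZeros x ∧ gCond x (π (leafOf M x)).val).card : ℝ) ≤
        (1 - 1 / (n : ℝ) ^ C) * (2 : ℝ) ^ (n - 1)

/-- **`AdaptiveAffinePointerLoss3` PROVED** (`C = 1`). -/
theorem adaptiveAffinePointerLoss3 : AdaptiveAffinePointerLoss3 := by
  refine ⟨1, fun c => ?_⟩
  obtain ⟨n₁, hn₁⟩ := TubePlanProof.logPow_le_natSqrt c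
  refine ⟨max n₁ 4096, fun n hn t ht M hM π => ?_⟩
  have hn1 : n₁ ≤ n := le_trans (le_max_left _ _) hn
  have h4096 : 4096 ≤ n := le_trans (le_max_right _ _) hn
  have hsq : (Nat.log 2 n) ^ c ≤ Nat.sqrt n := hn₁ n hn1
  have hs64 : 64 ≤ Nat.sqrt n := Nat.le_sqrt.2 (by omega)
  have hss : Nat.sqrt n * Nat.sqrt n ≤ n := Nat.sqrt_le n
  have htN : 16 * t + 42 ≤ n := by nlinarith [ht, hsq, hs64, hss]
  have h := adaptivePointer_loss n t htN M hM π
  have hn4 : (4 : ℝ) ≤ n := by exact_mod_cast h4096.trans' (by norm_num)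
  have h1n : 1 / (n : ℝ) ^ 1 ≤ 1 / 4 := by
    rw [pow_one]; exact one_div_le_one_div_of_le (by norm_num) hn4
  have hpos : (0 : ℝ) ≤ 2 ^ (n - 1) := by positivity
  have hrhs : (3 / 4 : ℝ) * 2 ^ (n - 1) ≤ (1 - 1 / (n : ℝ) ^ 1) * 2 ^ (n - 1) :=
    mul_le_mul_of_nonneg_right (by linarith) hpos
  linarith

/-- the non-adaptive law is the constant-scheme case. -/
theorem affinePointerLoss3_of_adaptive (h : AdaptiveAffinePointerLoss3) : AffinePointerLoss3 := by
  obtain ⟨C, hC⟩ := h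
  refine ⟨C, fun c => ?_⟩
  obtain ⟨n₀, hn₀⟩ := hC c
  refine ⟨n₀, fun n hn t ht M π => ?_⟩
  have h := hn₀ n hn t ht (fun _ => M) (adaptive_const M) π
  simp_rw [leafOf_const] at h
  exact h

/-! ### necessity: the leaf lookup is a free pointer of degree `2t` -/

/-- the ANCHOR FAMILY of an adaptive pointer: `A_k = Σ_{v : π v = k} [L^v = v]` (degree `2t`). -/
def adAnchor (M : (Fin t → ZMod 3) → Fin t → Fin N → ZMod 3) (π : (Fin t → ZMod 3) → Fin N) (k : Fin N) :
    CubeFn (ZMod 3) N :=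
  ∑ v ∈ univ.filter (fun v : Fin t → ZMod 3 => π v = k), fibInd (M v) v

/-- LocusDialAffinePointerD helper `adAnchor_apply` (decomp-qadv land package; see the module docstring). -/
theorem adAnchor_apply {M : (Fin t → ZMod 3) → Fin t → Fin N → ZMod 3} (hM : Adaptive M)
    (π : (Fin t → ZMod 3) → Fin N) (k : Fin N) (x : Fin N → Bool) :
    adAnchor M π k x = if π (leafOf M x) = k then 1 else 0 := by
  unfold adAnchor
  rw [Finset.sum_apply]
  have e : ∀ v : Fin t → ZMod 3, fibInd (M v) v x = if leafOf M x = v then 1 else 0 := fun v => by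
    rw [fibInd_apply]; exact if_congr (leafOf_eq_iff hM x v).symm rfl rfl
  simp_rw [e]
  rw [Finset.sum_ite_eq]
  simp only [mem_filter, mem_univ, true_and]

/-- LocusDialAffinePointerD helper `adAnchor_mem` (decomp-qadv land package; see the module docstring). -/
theorem adAnchor_mem (M : (Fin t → ZMod 3) → Fin t → Fin N → ZMod 3) (π : (Fin t → ZMod 3) → Fin N) (k : Fin N) :
    adAnchor M π k ∈ lowDeg (ZMod 3) N (t * 2) :=
  Submodule.sum_mem _ fun v _ => fibInd_mem (M v) v

/-- the adaptive pointer declares EXACTLY ONE position on every input. -/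
theorem adAnchor_filter {M : (Fin t → ZMod 3) → Fin t → Fin N → ZMod 3} (hM : Adaptive M)
    (π : (Fin t → ZMod 3) → Fin N) (x : Fin N → Bool) :
    (univ.filter fun k : Fin N => adAnchor M π k x = 1) = {π (leafOf M x)} := by
  ext k
  rw [mem_filter, mem_singleton, adAnchor_apply hM]
  by_cases h : π (leafOf M x) = k
  · rw [if_pos h]; exact ⟨fun _ => h.symm, fun _ => ⟨mem_univ _, rfl⟩⟩
  · rw [if_neg h]; exact ⟨fun h0 => absurd h0.2 zero_ne_one, fun hk => absurd hk.symm h⟩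

/-- **NECESSITY `FreePointerLoss3 → AdaptiveAffinePointerLoss3`**: the leaf lookup is a free pointer of degree
`2t ≤ (log₂ n)^{c+1}` with exact unique declaration on every input. -/
theorem adaptiveAffinePointerLoss3_of_freePointerLoss3 (h : FreePointerLoss3) : AdaptiveAffinePointerLoss3 := by
  obtain ⟨C, hC⟩ := h
  refine ⟨C, fun c => ?_⟩
  obtain ⟨n₀, hn₀⟩ := hC (c + 1)
  refine ⟨max n₀ 4, fun n hn t ht M hM π => ?_⟩
  have hn4 : 4 ≤ n := le_of_max_le_right hn
  have hdeg : t * 2 ≤ (Nat.log 2 n) ^ (c + 1) := by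
    have hL : 2 ≤ Nat.log 2 n := Nat.le_log_of_pow_le (by norm_num) (by norm_num; omega)
    rw [pow_succ]
    exact Nat.mul_le_mul ht hL
  have hA : ∀ k, adAnchor M π k ∈ lowDeg (ZMod 3) n ((Nat.log 2 n) ^ (c + 1)) := fun k =>
    lowDeg_mono hdeg (adAnchor_mem M π k)
  have huniq : ∀ x : Fin n → Bool, OddZeros x →
      (univ.filter fun k : Fin n => adAnchor M π k x = 1).card = 1 := fun x _ => by
    rw [adAnchor_filter hM, card_singleton]
  have hle := hn₀ n (le_of_max_le_left hn) _ hA huniq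
  have hset : (univ.filter fun x : Fin n → Bool => OddZeros x ∧ gCond x (π (leafOf M x)).val) =
      univ.filter fun x : Fin n → Bool =>
        OddZeros x ∧ ∃ k : Fin n, adAnchor M π k x = 1 ∧ gCond x k.val := by
    refine filter_congr fun x _ => and_congr_right fun _ => ⟨fun hg => ⟨π (leafOf M x), ?_, hg⟩, ?_⟩
    · rw [adAnchor_apply hM, if_pos rfl]
    · rintro ⟨k, hk, hg⟩
      rw [adAnchor_apply hM] at hk
      by_cases hpk : π (leafOf M x) = k
      · rw [hpk]; exact hg
      · rw [if_neg hpk] at hk; exact absurd hk zero_ne_one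
  rw [hset]
  exact hle

end Adaptive


end Summit.QuantumAdvantage.QuantumAdvantage.Theorems.LocusDial
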